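import Summits.Schanuel.Schanuel.Theorems.RootDecomp1EPointTransfer01

/-!
# RootDecomp1EPointTransfer — lens 2, generation 36 «POINT-TRANSFER CELL» (PointTransfer.lean v2 3559bc07…, 1387 l) — continuation (RootDecomp1EPointTransfer02): §4 KERNEL `expPoly_ne_zero_of_hyperRatScale` (P fixed, the L–W point moved; `maxHeartbeats 1600000` as in the source) and ENGINE `algebraicIndependent_exp_hyperLiouville_line (hRoy)`; `sb_hyperLiouville_line`

(lens-2 g36 `PointTransfer.lean` v2, sha256 3559bc07…2e21, own farm rc 0 · 0 sorry · axioms std; critic VERDICT STATUS L1667 PORT GO LOW;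
port by census-1 gen 15 in four parts `RootDecomp1EPointTransfer01`–`04` — see the PORT NOTE of part 01; `--supports stmt-Schanuel-31409`; rung 0.)
-/

noncomputable section

open Complex IntermediateField
open Summit.Schanuel.Schanuel.Theorems.RootDecomp1KHyper (SB SFset mvlen mvlen_nonneg abs_coeff_le_mvlen
  one_le_mvlen sb_of_algebraicIndependent exists_le_two_pow exists_int_mul_eq_map mvaeval_int_map
  mem_adjoin_SFset_I')
open Summit.Schanuel.Schanuel.Theorems.RootDecomp1KHyper.HyperCell (HyperLiouville hexp hexp_succ lambdaH
  hyperLiouville_lambdaH lambdaH_partialSum lambdaH_tail_pos lambdaH_tail_le lambdaH_eq_partialSum_add_tail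
  summable_lambdaH succ_le_hexp one_le_hexp)
open Summit.Schanuel.Schanuel.Theorems.RootDecomp1EScaleTransfer (expPoly prod_exp_pow_eq expPoly_eq_sum
  differentiable_expPoly exists_lipschitz_expPoly linearIndependent_scale linearIndependent_of_scale s2 s2_mul_s2 ω4 y3
  isAlgebraic_s2 ω4_algebraic ω4_linearIndependent y3_linearIndependent s2_not_rat y3_zero y3_one y3_two ih_at_three)

namespace Summit.Schanuel.Schanuel.Theorems.RootDecomp1EPointTransfer

/-- `exp(−x) ≤ 1/x` for `x > 0`. -/
private theorem exp_neg_le_one_div {x : ℝ} (hx : 0 < x) : Real.exp (-x) ≤ 1 / x := by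
  rw [Real.exp_neg, ← one_div]
  exact one_div_le_one_div_of_le hx (by linarith [Real.add_one_le_exp x])

/-! ## §4 The KERNEL and the ENGINE -/

set_option maxHeartbeats 1600000 in
/-- **POINT-TRANSFER KERNEL.** `P(e^{ξ y₁}, …, e^{ξ yₙ}) ≠ 0` for every non-zero `P ∈ ℤ[X₁, …, Xₙ]` when
`y ∈ ℚ̄ⁿ` is ℚ-free and the scale `ξ` is hyper-rational (mod `hRoy`).  At an approximant `r` of order `m`,
`r·y` is an algebraic ℚ-free point with `ℚ(r·y) = ℚ(y)`, house `≤ |r|·c_y`, denominator `den r · q_y`, so Roy's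
measure gives `|P(e^{r y})| ≥ H^{−X} exp(−(|num r| A)^E)` with `X, A, E` INDEPENDENT of `r`, while the Lipschitz
bound gives `|P(e^{r y})| ≤ K |r − ξ| < K exp(−b^m)`, `b = 2 + |num r| + den r ≥ |num r|`; `m = E + m₀`. -/
theorem expPoly_ne_zero_of_hyperRatScale (hRoy : Roy2014_thm_1_1) {n : ℕ} {y : Fin n → ℂ}
    (hyalg : ∀ j, IsAlgebraic ℚ (y j)) (hy : LinearIndependent ℚ y) {ξ : ℂ} (hξ : HyperRatScale ξ)
    {P : MvPolynomial (Fin n) ℤ} (hP : P ≠ 0) : expPoly y P ξ ≠ 0 := by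
  intro hroot
  classical
  obtain ⟨K, δ, hK, hδ, hLip⟩ := exists_lipschitz_expPoly y P ξ hroot
  -- the frame field and its data (all independent of the approximant)
  set F : IntermediateField ℚ ℂ := IntermediateField.adjoin ℚ (Set.range y) with hFdef
  haveI hFD : FiniteDimensional ℚ F := finiteDimensional_adjoin_range hyalg
  have hyF : ∀ j, y j ∈ F := fun j => IntermediateField.subset_adjoin _ _ ⟨j, rfl⟩
  set d : ℕ := Module.finrank ℚ F with hd
  obtain ⟨qy, hqy, hqyint⟩ := exists_den hyalg
  obtain ⟨cy, hcy0, hcy⟩ := exists_house hyalg F hyF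
  set D : ℕ := P.totalDegree + 1 with hD
  set H : ℕ := (mvlen P).toNat with hH
  have hHZ : (H : ℤ) = mvlen P := by rw [hH, Int.toNat_of_nonneg (mvlen_nonneg P)]
  have hH1 : 1 ≤ H := by
    have : (1 : ℤ) ≤ H := by rw [hHZ]; exact one_le_mvlen hP
    exact_mod_cast this
  have hH1R : (1 : ℝ) ≤ H := by exact_mod_cast hH1
  have hcoeffP : ∀ a, |P.coeff a| ≤ (H : ℤ) := fun a => by rw [hHZ]; exact abs_coeff_le_mvlen P a
  set S : ℕ := royS d n D with hS
  set E : ℕ := 18 * S ^ n with hE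
  set X : ℕ := 3 * d * S ^ n with hX
  set A : ℝ := cy * qy * S with hA
  have hA0 : 0 ≤ A := by positivity
  set L : ℝ := Real.log K + (X : ℝ) * Real.log H with hL
  have hK0 : 0 < K := by linarith
  have hlogK : 0 ≤ Real.log K := Real.log_nonneg hK
  have hlogH : 0 ≤ Real.log H := Real.log_nonneg hH1R
  have hL0 : 0 ≤ L := by positivity
  have hδinv : 0 < δ⁻¹ := inv_pos.mpr hδ
  obtain ⟨m₀, hm₀⟩ := exists_le_two_pow (L + A ^ E + δ⁻¹ + 1)
  set m : ℕ := E + m₀ with hm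
  -- the approximant of order m
  obtain ⟨r, hr0, hdist⟩ := hξ m
  set b : ℝ := 2 + |(r.num : ℝ)| + r.den with hb
  have hb2 : (2 : ℝ) ≤ b := by
    have h1 : (0 : ℝ) ≤ |(r.num : ℝ)| := abs_nonneg _
    have h2 : (0 : ℝ) ≤ (r.den : ℝ) := Nat.cast_nonneg _
    rw [hb]; linarith
  have hb1 : (1 : ℝ) ≤ b := by linarith
  have hb0 : (0 : ℝ) ≤ b := by linarith
  have hnum_le : |(r.num : ℝ)| ≤ b := by
    rw [hb]; linarith [Nat.cast_nonneg (α := ℝ) r.den]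
  -- Roy's hypotheses at the point α = r·y
  set α : Fin n → ℂ := fun j => (r : ℂ) * y j with hα
  have hr0C : (r : ℂ) ≠ 0 := by exact_mod_cast hr0
  have hralg : IsAlgebraic ℚ ((r : ℚ) : ℂ) := by
    simpa [eq_ratCast] using isAlgebraic_algebraMap (R := ℚ) (A := ℂ) r
  have hαalg : ∀ j, IsAlgebraic ℚ (α j) := fun j => hralg.mul (hyalg j)
  have hαli : LinearIndependent ℚ α := linearIndependent_scale hr0C hy
  have hrF : ((r : ℚ) : ℂ) ∈ F := by
    have h := IntermediateField.algebraMap_mem F r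
    rwa [eq_ratCast] at h
  have hαF : ∀ j, α j ∈ F := fun j => mul_mem hrF (hyF j)
  have hconj : ∀ (σ : F →ₐ[ℚ] ℂ) (j : Fin n), ‖σ ⟨α j, hαF j⟩‖ ≤ |(r : ℝ)| * cy := by
    intro σ j
    have e : (⟨α j, hαF j⟩ : F) = algebraMap ℚ F r * ⟨y j, hyF j⟩ := by
      apply Subtype.ext
      change (r : ℂ) * y j = ((algebraMap ℚ F r : F) : ℂ) * y j
      congr 1
    rw [e, map_mul, AlgHom.commutes, norm_mul, eq_ratCast]
    have hn : ‖((r : ℚ) : ℂ)‖ = |(r : ℝ)| := by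
      rw [show ((r : ℚ) : ℂ) = ((r : ℝ) : ℂ) by norm_cast, Complex.norm_real, Real.norm_eq_abs]
    rw [hn]
    exact mul_le_mul_of_nonneg_left (hcy σ j) (abs_nonneg _)
  have hq : 0 < r.den * qy := Nat.mul_pos r.den_pos hqy
  have hqα : ∀ j, IsIntegral ℤ (((r.den * qy : ℕ) : ℂ) * α j) := by
    intro j
    have h1 : ((r.den : ℕ) : ℂ) * (r : ℂ) = ((r.num : ℤ) : ℂ) := by exact_mod_cast Rat.den_mul_eq_num r
    have e : ((r.den * qy : ℕ) : ℂ) * α j = ((r.num : ℤ) : ℂ) * ((qy : ℂ) * y j) := by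
      simp only [hα]; push_cast; rw [← h1]; ring
    rw [e]
    exact isIntegral_algebraMap.mul (hqyint j)
  have hdα : Module.finrank ℚ ↥(IntermediateField.adjoin ℚ (Set.range α)) = d := by
    rw [hd, hFdef, ← adjoin_range_smul y hr0]
  have hlow := hRoy n α hαalg hαli F hαF hFD (|(r : ℝ)| * cy) hconj (r.den * qy) hq hqα d hdα D H
    (Nat.succ_pos _) hH1 P hP (Nat.le_succ _) hcoeffP
  have hval : MvPolynomial.aeval (fun i => cexp (α i)) P = expPoly y P r := rfl
  rw [hval] at hlow
  -- Roy's bound, uniformly in r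
  have hcqS : |(r : ℝ)| * cy * ((r.den * qy : ℕ) : ℝ) * ((royS d n D : ℕ) : ℝ) = |(r.num : ℝ)| * A := by
    rw [abs_num_eq, hA, ← hS]; push_cast; ring
  have hRoyB : royBound n (|(r : ℝ)| * cy) (r.den * qy) d D H =
      ((H : ℝ) ^ X)⁻¹ * Real.exp (-((|(r.num : ℝ)| * A) ^ E)) := by
    unfold royBound
    rw [hcqS, ← hS]
  rw [hRoyB] at hlow
  have hpowle : (|(r.num : ℝ)| * A) ^ E ≤ b ^ E * A ^ E := by
    rw [← mul_pow]
    exact pow_le_pow_left₀ (by positivity) (mul_le_mul_of_nonneg_right hnum_le hA0) E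
  have hHX : 0 < ((H : ℝ) ^ X)⁻¹ := by positivity
  have hlow' : ((H : ℝ) ^ X)⁻¹ * Real.exp (-(b ^ E * A ^ E)) ≤ ‖expPoly y P r‖ :=
    le_trans (mul_le_mul_of_nonneg_left (Real.exp_le_exp.mpr (neg_le_neg hpowle)) hHX.le) hlow
  -- the order m beats everything
  have hbm₀ : L + A ^ E + δ⁻¹ + 1 ≤ b ^ m₀ :=
    hm₀.trans (pow_le_pow_left₀ (by norm_num) hb2 m₀)
  have hbEm : b ^ m = b ^ E * b ^ m₀ := by rw [hm, pow_add]
  have hbE1 : (1 : ℝ) ≤ b ^ E := one_le_pow₀ hb1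
  have hbm : L + b ^ E * A ^ E ≤ b ^ m := by
    rw [hbEm]
    have h1 : b ^ E * (L + A ^ E) ≤ b ^ E * b ^ m₀ :=
      mul_le_mul_of_nonneg_left (by linarith [hδinv.le]) (by positivity)
    have h2 : L ≤ b ^ E * L := le_mul_of_one_le_left hL0 hbE1
    nlinarith
  have hbm_ge : δ⁻¹ + 1 ≤ b ^ m := by
    have : b ^ m₀ ≤ b ^ m := pow_le_pow_right₀ hb1 (by omega)
    have hAE : 0 ≤ A ^ E := by positivity
    linarith
  -- the approximant lies in the Lipschitz ball
  have hdist' : ‖(r : ℂ) - ξ‖ < Real.exp (-b ^ m) := by rwa [norm_sub_rev]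
  have hsmall : Real.exp (-b ^ m) < δ := by
    have h1 : Real.exp (-b ^ m) ≤ 1 / b ^ m := exp_neg_le_one_div (by linarith)
    have h2 : 1 / b ^ m < δ := by
      rw [div_lt_iff₀ (by linarith)]
      have hδδ : δ * δ⁻¹ = 1 := mul_inv_cancel₀ hδ.ne'
      have h3 : δ * (δ⁻¹ + 1) ≤ δ * b ^ m := mul_le_mul_of_nonneg_left hbm_ge hδ.le
      rw [mul_add, hδδ, mul_one] at h3
      linarith
    linarith
  have hup : ‖expPoly y P r‖ < K * Real.exp (-b ^ m) :=
    lt_of_le_of_lt (hLip r (hdist'.trans hsmall)) (mul_lt_mul_of_pos_left hdist' hK0)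
  -- K·exp(−b^m) ≤ H^{−X}·exp(−b^E A^E): contradiction
  have hexpL : Real.exp L = K * (H : ℝ) ^ X := by
    rw [hL, Real.exp_add, Real.exp_log hK0, Real.exp_nat_mul, Real.exp_log (by linarith)]
  have hkey : K * Real.exp (-b ^ m) ≤ ((H : ℝ) ^ X)⁻¹ * Real.exp (-(b ^ E * A ^ E)) := by
    have h1 : Real.exp (-b ^ m) ≤ Real.exp (-(L + b ^ E * A ^ E)) :=
      Real.exp_le_exp.mpr (by linarith)
    have h2 : Real.exp (-(L + b ^ E * A ^ E)) = (K * (H : ℝ) ^ X)⁻¹ * Real.exp (-(b ^ E * A ^ E)) := by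
      rw [neg_add, Real.exp_add, Real.exp_neg, hexpL]
    calc K * Real.exp (-b ^ m) ≤ K * ((K * (H : ℝ) ^ X)⁻¹ * Real.exp (-(b ^ E * A ^ E))) := by
          rw [← h2]; exact mul_le_mul_of_nonneg_left h1 hK0.le
      _ = ((H : ℝ) ^ X)⁻¹ * Real.exp (-(b ^ E * A ^ E)) := by
          field_simp
  linarith

/-- **THE POINT-TRANSFER THEOREM.** For `y ∈ ℚ̄ⁿ` ℚ-free and a hyper-rational scale `ξ`, the exponentials
`e^{ξ y₁}, …, e^{ξ yₙ}` are algebraically independent over `ℚ` (mod `hRoy`). -/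
theorem algebraicIndependent_exp_of_hyperRatScale (hRoy : Roy2014_thm_1_1) {n : ℕ} {y : Fin n → ℂ}
    (hyalg : ∀ j, IsAlgebraic ℚ (y j)) (hy : LinearIndependent ℚ y) {ξ : ℂ} (hξ : HyperRatScale ξ) :
    AlgebraicIndependent ℚ (fun j => cexp (ξ * y j)) := by
  rw [algebraicIndependent_iff]
  intro g hg
  obtain ⟨Nz, G, hNz, hG⟩ := exists_int_mul_eq_map g
  by_contra hg0
  have hG0 : G ≠ 0 := by
    intro h0
    rw [h0, map_zero, eq_comm, mul_eq_zero] at hG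
    rcases hG with h | h
    · exact hNz (by exact_mod_cast (MvPolynomial.C_eq_zero.mp h))
    · exact hg0 h
  have hval : expPoly y G ξ = 0 := by
    unfold expPoly
    rw [← mvaeval_int_map _ G, hG, map_mul, hg, mul_zero]
  exact expPoly_ne_zero_of_hyperRatScale hRoy hyalg hy hξ hG0 hval

/-- **Schanuel's bound on the line**: `trdeg ℚ(ξy, e^{ξy}) ≥ n` — `S` itself at every length `n`. -/
theorem sb_of_hyperRatScale (hRoy : Roy2014_thm_1_1) {n : ℕ} {y : Fin n → ℂ}
    (hyalg : ∀ j, IsAlgebraic ℚ (y j)) (hy : LinearIndependent ℚ y) {ξ : ℂ} (hξ : HyperRatScale ξ) :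
    SB n (fun j => ξ * y j) :=
  sb_of_algebraicIndependent (algebraicIndependent_exp_of_hyperRatScale hRoy hyalg hy hξ) (by simp)
    fun j => mem_adjoin_SFset_I' (Or.inr ⟨j, rfl⟩)

/-- **Schanuel's conjecture holds at `ρ · y` for EVERY hyper-Liouville real `ρ` and EVERY ℚ-free
algebraic frame `y`** (mod `hRoy`) — the exponentials `e^{ρ y_j}` alone are algebraically independent. -/
theorem algebraicIndependent_exp_hyperLiouville_line (hRoy : Roy2014_thm_1_1) {n : ℕ} {y : Fin n → ℂ}
    (hyalg : ∀ j, IsAlgebraic ℚ (y j)) (hy : LinearIndependent ℚ y) {ρ : ℝ} (hρ : HyperLiouville ρ) :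
    AlgebraicIndependent ℚ (fun j => cexp ((ρ : ℂ) * y j)) :=
  algebraicIndependent_exp_of_hyperRatScale hRoy hyalg hy (hyperRatScale_of_hyperLiouville hρ)

/-- Schanuel's bound `SB n (ρ·y)` on a hyper-Liouville line over an algebraic ℚ-free frame (mod `hRoy`). -/
theorem sb_hyperLiouville_line (hRoy : Roy2014_thm_1_1) {n : ℕ} {y : Fin n → ℂ}
    (hyalg : ∀ j, IsAlgebraic ℚ (y j)) (hy : LinearIndependent ℚ y) {ρ : ℝ} (hρ : HyperLiouville ρ) :
    SB n (fun j => (ρ : ℂ) * y j) :=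
  sb_of_hyperRatScale hRoy hyalg hy (hyperRatScale_of_hyperLiouville hρ)

/-- **Tightness: ℚ-freeness of the frame is NECESSARY** — on the frame `(1, 1)` the exponentials
coincide. -/
theorem frame_free_necessary (ξ : ℂ) :
    ¬ AlgebraicIndependent ℚ (fun j : Fin 2 => cexp (ξ * ![(1 : ℂ), 1] j)) := by
  intro h
  have h01 : (fun j : Fin 2 => cexp (ξ * ![(1 : ℂ), 1] j)) 0 =
      (fun j : Fin 2 => cexp (ξ * ![(1 : ℂ), 1] j)) 1 := by simp
  exact absurd (h.injective h01) (by decide)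

/-- **Tightness: SOME Diophantine condition on the scale is NECESSARY** — at `ξ = log 2` on the frame
`(1)` the exponential `e^{ξ} = 2` is algebraic. -/
theorem scale_condition_necessary :
    ¬ AlgebraicIndependent ℚ (fun j : Fin 1 => cexp ((Real.log 2 : ℂ) * ![(1 : ℂ)] j)) := by
  intro h
  have ht := h.transcendental 0
  apply ht
  have e : cexp ((Real.log 2 : ℂ) * ![(1 : ℂ)] 0) = 2 := by
    simp only [Matrix.cons_val_fin_one, mul_one]
    rw [← Complex.ofReal_exp, Real.exp_log two_pos]; norm_num
  rw [e]; exact_mod_cast isAlgebraic_algebraMap (2 : ℚ)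

end Summit.Schanuel.Schanuel.Theorems.RootDecomp1EPointTransfer
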